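import Summits.HodgeConjecture.HodgeConjecture.Theorems.PadicSemiregularLiftHodgeFermatVarietiesFiveQUnits
import Literature.AlgebraicGeometry.HodgeTheory.FermatHodgeCharactersPrimePow
import HarnessLib

/-!
# Hodge sextuples of level `5q`, III: the symmetric case gives three pairs — line `cancel-by-any-claim-lattice`, crux `HodgeFermatVarieties` (stmt-HodgeConjecture-1334)

Fourth file of lead c3's level-`5q` programme (prime `q ≥ 7`). If the UNIT part of a Hodge multiset `s` of
`ℤ/5q` is symmetric (`c(x) = c(-x)` for every unit `x`; first alternative of `structure_units`), then `s` is
fully symmetric and hence a sum of pairs `{a, -a}`: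

* the unit part of the level-`q` relation (II) vanishes by symmetry (the summand `χ(x mod q)⁻¹` is odd), so
  (II) says that the push-forward of the NON-UNIT entries to `ℤ/q` is orthogonal to every odd character,
  hence even (`even_of_orthogonal_odd`); a non-unit entry with non-zero reduction mod `q` is of level `q`
  and is determined by that reduction (CRT), so `c(x) = c(-x)` for the level-`q` residues; the level-`5`
  residues are handled by (III) in the same way;
* a symmetric multiset of an odd modulus is `Q + (-Q)` (`FermatCharacter.exists_eq_add_map_neg`, tree).

References: [Aoki1983] N. Aoki, Math. Ann. 266 (1983) §2 (Prop. 2.2).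
-/

set_option linter.dupNamespace false

noncomputable section

open Finset
open Literature.AlgebraicGeometry.HodgeTheory Literature.AlgebraicGeometry.HodgeTheory.FermatCharacter

open Summit.HodgeConjecture.HodgeConjecture.Theorems.CancelByAnyClaimLattice.FiveQ

namespace Summit.HodgeConjecture.HodgeConjecture.Theorems.CancelByAnyClaimLattice.PQ

section LevelPQ

variable {p q : ℕ} [Fact p.Prime] [Fact q.Prime]

/-! ### §1 The unit part of an odd summand vanishes on a symmetric unit part -/

/-- **A sum over the unit entries of an odd function vanishes when the unit part is symmetric.**
[folklore] -/
theorem sum_filter_isUnit_eq_zero {s : Multiset (ZMod (p * q))}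
    (hsym : ∀ x : (ZMod (p * q))ˣ, Multiset.count (x : ZMod (p * q)) s = Multiset.count (-(x : ZMod (p * q))) s)
    (f : ZMod (p * q) → ℂ) (hf : ∀ x : (ZMod (p * q))ˣ, f (-(x : ZMod (p * q))) = -f x) :
    ((s.filter IsUnit).map f).sum = 0 := by
  classical
  rw [multiset_sum_eq_sum_count, sum_univ_eq_sum_units]
  · have hcount : ∀ x : (ZMod (p * q))ˣ, Multiset.count (x : ZMod (p * q)) (s.filter IsUnit) =
        Multiset.count (x : ZMod (p * q)) s := fun x ↦ by
      rw [Multiset.count_filter, if_pos (Units.isUnit x)]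
    simp_rw [hcount]
    have h : ∑ x : (ZMod (p * q))ˣ, (Multiset.count (x : ZMod (p * q)) s : ℂ) * f x =
        ∑ x : (ZMod (p * q))ˣ, (Multiset.count ((-x : (ZMod (p * q))ˣ) : ZMod (p * q)) s : ℂ) * f ((-x : (ZMod (p * q))ˣ) : ZMod (p * q)) :=
      (Fintype.sum_equiv (Equiv.neg _) _ _ fun x ↦ by simp).symm
    simp only [Units.val_neg, hf, ← hsym, mul_neg, Finset.sum_neg_distrib] at h
    linear_combination h / 2
  · intro y hy
    rw [Multiset.count_filter, if_neg hy, Nat.cast_zero, zero_mul]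

/-! ### §2 Level-`q` residues: (II) makes their multiplicities symmetric -/

/-- **Push-forward of the non-unit entries to `ℤ/q` against a character.** [folklore] -/
theorem sum_card_filter_nonunit_mul (t : Multiset (ZMod (p * q))) (ψ : DirichletCharacter ℂ q) :
    ∑ y : ZMod q, (Multiset.card ((t.filter fun x ↦ ¬ IsUnit x).filter
        fun x ↦ ZMod.castHom (dvd_mul_left q p) (ZMod q) x = y) : ℂ) * ψ y =
      ((t.filter fun x ↦ ¬ IsUnit x).map fun x ↦ ψ (ZMod.castHom (dvd_mul_left q p) (ZMod q) x)).sum := by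
  classical
  generalize t.filter (fun x ↦ ¬ IsUnit x) = u
  induction u using Multiset.induction_on with
  | empty => simp
  | cons x u ih =>
    rw [Multiset.map_cons, Multiset.sum_cons, ← ih]
    have hsplit : ∀ y : ZMod q,
        (Multiset.card ((x ::ₘ u).filter fun z ↦ ZMod.castHom (dvd_mul_left q p) (ZMod q) z = y) : ℂ) * ψ y =
          (if ZMod.castHom (dvd_mul_left q p) (ZMod q) x = y then ψ y else 0) +
            (Multiset.card (u.filter fun z ↦ ZMod.castHom (dvd_mul_left q p) (ZMod q) z = y) : ℂ) * ψ y := by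
      intro y
      rw [Multiset.filter_cons]
      split_ifs with hxy
      · simp; ring
      · simp
    rw [Finset.sum_congr rfl fun y _ ↦ hsplit y, Finset.sum_add_distrib, Finset.sum_ite_eq]
    simp

/-- **A non-unit entry with non-zero reduction mod `q` is determined by that reduction** (it is of level
`q`: reduction mod `p` zero; CRT). [folklore] -/
theorem eq_of_nonunit_of_cast_eq (hpq : p ≠ q) {x y : ZMod (p * q)} (hx0 : x ≠ 0) (hy0 : y ≠ 0)
    (hx : ¬ IsUnit x) (hy : ¬ IsUnit y)
    (hxq : ZMod.castHom (dvd_mul_left q p) (ZMod q) x ≠ 0)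
    (h : ZMod.castHom (dvd_mul_left q p) (ZMod q) x = ZMod.castHom (dvd_mul_left q p) (ZMod q) y) : x = y := by
  rcases trichotomy hpq hx0 with hu | ⟨hx5, -⟩ | ⟨-, hxq0⟩
  · exact absurd hu hx
  · rcases trichotomy hpq hy0 with hu | ⟨hy5, -⟩ | ⟨-, hyq0⟩
    · exact absurd hu hy
    · exact eq_of_casts_eq hpq (hx5.trans hy5.symm) h
    · rw [hyq0] at h; exact absurd h hxq
  · exact absurd hxq0 hxq

/-- **Multiplicity of a level-`q` residue as a push-forward count**: for `x` of level `q`,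
`c(x) = #{y ∈ s : y non-unit, y ≡ x (q)}` (such `y` equal `x`). [folklore] -/
theorem count_eq_card_filter_of_level_q (hpq : p ≠ q) {s : Multiset (ZMod (p * q))} (hs0 : ∀ y ∈ s, y ≠ 0)
    {x : ZMod (p * q)} (hx0 : x ≠ 0) (hx : ¬ IsUnit x) (hxq : ZMod.castHom (dvd_mul_left q p) (ZMod q) x ≠ 0) :
    Multiset.count x s = Multiset.card ((s.filter fun y ↦ ¬ IsUnit y).filter
      fun y ↦ ZMod.castHom (dvd_mul_left q p) (ZMod q) y = ZMod.castHom (dvd_mul_left q p) (ZMod q) x) := by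
  classical
  rw [Multiset.filter_filter, Multiset.count_eq_card_filter_eq]
  congr 1
  refine Multiset.filter_congr fun y hy ↦ ⟨fun h ↦ ?_, fun h ↦ ?_⟩
  · subst h; exact ⟨rfl, hx⟩
  · exact eq_of_nonunit_of_cast_eq hpq hx0 (hs0 y hy) hx h.2 hxq h.1.symm

/-- **(II) on a symmetric unit part: the level-`q` multiplicities are symmetric.**
[cite: Aoki1983, Prop. 2.2] -/
theorem count_symm_level_q (hpq : p ≠ q) {s : Multiset (ZMod (p * q))} (hs : IsHodgeMultiset s)
    (hsym : ∀ x : (ZMod (p * q))ˣ, Multiset.count (x : ZMod (p * q)) s = Multiset.count (-(x : ZMod (p * q))) s)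
    {x : ZMod (p * q)} (hx0 : x ≠ 0) (hx : ¬ IsUnit x) (hxq : ZMod.castHom (dvd_mul_left q p) (ZMod q) x ≠ 0) :
    Multiset.count x s = Multiset.count (-x) s := by
  classical
  have hnx0 : -x ≠ 0 := neg_ne_zero.mpr hx0
  have hnx : ¬ IsUnit (-x) := fun h ↦ hx (by simpa using h.neg)
  have hnxq : ZMod.castHom (dvd_mul_left q p) (ZMod q) (-x) ≠ 0 := by rw [map_neg, neg_ne_zero]; exact hxq
  rw [count_eq_card_filter_of_level_q hpq hs.1.1 hx0 hx hxq, count_eq_card_filter_of_level_q hpq hs.1.1 hnx0 hnx hnxq,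
    map_neg]
  -- the push-forward `F` of the non-unit entries is orthogonal to the odd characters mod `q`
  set F : ZMod q → ℂ := fun y ↦ Multiset.card ((s.filter fun z ↦ ¬ IsUnit z).filter
    fun z ↦ ZMod.castHom (dvd_mul_left q p) (ZMod q) z = y) with hF
  have hxunit : IsUnit (ZMod.castHom (dvd_mul_left q p) (ZMod q) x) := (isUnit_iff_ne_zero_prime _).mpr hxq
  have key := even_of_orthogonal_odd F ?_ hxunit.unit
  · simp only [IsUnit.unit_spec, hF] at key
    exact_mod_cast key
  intro ψ hψ
  rw [hF, sum_card_filter_nonunit_mul]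
  -- (II) for `ψ⁻¹`; the unit part vanishes by symmetry
  have h2 := stub_twoPrime_level_right p q hpq s hs ψ⁻¹ (inv_neg_one_of_odd hψ) (ne_one_of_odd (inv_neg_one_of_odd hψ))
  rw [← Multiset.filter_add_not (p := IsUnit) s, Multiset.map_add, Multiset.sum_add] at h2
  have hunit : ((s.filter IsUnit).map fun y ↦
      (if IsUnit y then (1 - ψ⁻¹ ((p : ℕ) : ZMod q)) else ((p - 1 : ℕ) : ℂ) * ψ⁻¹ ((p : ℕ) : ZMod q)) *
        (ψ⁻¹ (ZMod.castHom (dvd_mul_left q p) (ZMod q) y))⁻¹).sum = 0 := by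
    have : ((s.filter IsUnit).map fun y ↦
        (if IsUnit y then (1 - ψ⁻¹ ((p : ℕ) : ZMod q)) else ((p - 1 : ℕ) : ℂ) * ψ⁻¹ ((p : ℕ) : ZMod q)) *
          (ψ⁻¹ (ZMod.castHom (dvd_mul_left q p) (ZMod q) y))⁻¹) =
        ((s.filter IsUnit).map fun y ↦ (1 - ψ⁻¹ ((p : ℕ) : ZMod q)) * ψ (ZMod.castHom (dvd_mul_left q p) (ZMod q) y)) := by
      refine Multiset.map_congr rfl fun y hy ↦ ?_
      rw [Multiset.mem_filter] at hy
      rw [if_pos hy.2, inv_inv_apply]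
    rw [this, Multiset.sum_map_mul_left,
      sum_filter_isUnit_eq_zero hsym (fun y ↦ ψ (ZMod.castHom (dvd_mul_left q p) (ZMod q) y)) ?_, mul_zero]
    intro y
    rw [map_neg, ← neg_one_mul, map_mul, hψ, neg_one_mul]
  rw [hunit, zero_add] at h2
  have hnon : ((s.filter fun y ↦ ¬ IsUnit y).map fun y ↦
      (if IsUnit y then (1 - ψ⁻¹ ((p : ℕ) : ZMod q)) else ((p - 1 : ℕ) : ℂ) * ψ⁻¹ ((p : ℕ) : ZMod q)) *
        (ψ⁻¹ (ZMod.castHom (dvd_mul_left q p) (ZMod q) y))⁻¹) =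
      ((s.filter fun y ↦ ¬ IsUnit y).map fun y ↦
        (((p - 1 : ℕ) : ℂ) * ψ⁻¹ ((p : ℕ) : ZMod q)) * ψ (ZMod.castHom (dvd_mul_left q p) (ZMod q) y)) := by
    refine Multiset.map_congr rfl fun y hy ↦ ?_
    rw [Multiset.mem_filter] at hy
    rw [if_neg hy.2, inv_inv_apply]
  rw [hnon, Multiset.sum_map_mul_left] at h2
  have h5 : IsUnit ((p : ℕ) : ZMod q) := by
    rw [ZMod.isUnit_prime_iff_not_dvd (Fact.out : p.Prime)]
    intro h
    exact hpq ((Nat.prime_dvd_prime_iff_eq (Fact.out : p.Prime) Fact.out).mp h)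
  have hne : (((p - 1 : ℕ) : ℂ) * ψ⁻¹ ((p : ℕ) : ZMod q)) ≠ 0 := by
    refine mul_ne_zero ?_ ?_
    · have hp2 : 2 ≤ p := (Fact.out : p.Prime).two_le
      have : (p - 1 : ℕ) ≠ 0 := by omega
      exact_mod_cast this
    rw [MulChar.inv_apply_eq_inv']
    exact inv_ne_zero ((h5.map ψ).ne_zero)
  exact (mul_eq_zero.mp h2).resolve_left hne

/-! ### §3 Level-`p` residues: (III) makes their multiplicities symmetric (mirror of §2) -/

/-- **Push-forward of the non-unit entries to `ℤ/p` against a character.** [folklore] -/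
theorem sum_card_filter_nonunit_mul' (t : Multiset (ZMod (p * q))) (ψ : DirichletCharacter ℂ p) :
    ∑ y : ZMod p, (Multiset.card ((t.filter fun x ↦ ¬ IsUnit x).filter
        fun x ↦ ZMod.castHom (dvd_mul_right p q) (ZMod p) x = y) : ℂ) * ψ y =
      ((t.filter fun x ↦ ¬ IsUnit x).map fun x ↦ ψ (ZMod.castHom (dvd_mul_right p q) (ZMod p) x)).sum := by
  classical
  generalize t.filter (fun x ↦ ¬ IsUnit x) = u
  induction u using Multiset.induction_on with
  | empty => simp
  | cons x u ih =>
    rw [Multiset.map_cons, Multiset.sum_cons, ← ih]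
    have hsplit : ∀ y : ZMod p,
        (Multiset.card ((x ::ₘ u).filter fun z ↦ ZMod.castHom (dvd_mul_right p q) (ZMod p) z = y) : ℂ) * ψ y =
          (if ZMod.castHom (dvd_mul_right p q) (ZMod p) x = y then ψ y else 0) +
            (Multiset.card (u.filter fun z ↦ ZMod.castHom (dvd_mul_right p q) (ZMod p) z = y) : ℂ) * ψ y := by
      intro y
      rw [Multiset.filter_cons]
      split_ifs with hxy
      · simp; ring
      · simp
    rw [Finset.sum_congr rfl fun y _ ↦ hsplit y, Finset.sum_add_distrib, Finset.sum_ite_eq]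
    simp

/-- **A non-unit residue with non-zero reduction mod `p` is determined by that reduction** (level `p`;
CRT). [folklore] -/
theorem eq_of_nonunit_of_cast_eq' (hpq : p ≠ q) {x y : ZMod (p * q)} (hx0 : x ≠ 0) (hy0 : y ≠ 0)
    (hx : ¬ IsUnit x) (hy : ¬ IsUnit y)
    (hx5 : ZMod.castHom (dvd_mul_right p q) (ZMod p) x ≠ 0)
    (h : ZMod.castHom (dvd_mul_right p q) (ZMod p) x = ZMod.castHom (dvd_mul_right p q) (ZMod p) y) : x = y := by
  rcases trichotomy hpq hx0 with hu | ⟨hx50, -⟩ | ⟨-, hxq⟩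
  · exact absurd hu hx
  · exact absurd hx50 hx5
  · rcases trichotomy hpq hy0 with hu | ⟨hy50, -⟩ | ⟨-, hyq⟩
    · exact absurd hu hy
    · rw [hy50] at h; exact absurd h hx5
    · exact eq_of_casts_eq hpq h (hxq.trans hyq.symm)

/-- **Multiplicity of a level-`p` residue as a push-forward count.** [folklore] -/
theorem count_eq_card_filter_of_level_p (hpq : p ≠ q) {s : Multiset (ZMod (p * q))} (hs0 : ∀ y ∈ s, y ≠ 0)
    {x : ZMod (p * q)} (hx0 : x ≠ 0) (hx : ¬ IsUnit x) (hx5 : ZMod.castHom (dvd_mul_right p q) (ZMod p) x ≠ 0) :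
    Multiset.count x s = Multiset.card ((s.filter fun y ↦ ¬ IsUnit y).filter
      fun y ↦ ZMod.castHom (dvd_mul_right p q) (ZMod p) y = ZMod.castHom (dvd_mul_right p q) (ZMod p) x) := by
  classical
  rw [Multiset.filter_filter, Multiset.count_eq_card_filter_eq]
  congr 1
  refine Multiset.filter_congr fun y hy ↦ ⟨fun h ↦ ?_, fun h ↦ ?_⟩
  · subst h; exact ⟨rfl, hx⟩
  · exact eq_of_nonunit_of_cast_eq' hpq hx0 (hs0 y hy) hx h.2 hx5 h.1.symm

/-- **(III) on a symmetric unit part: the level-`p` multiplicities are symmetric.**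
[cite: Aoki1983, Prop. 2.2] -/
theorem count_symm_level_p (hpq : p ≠ q) {s : Multiset (ZMod (p * q))} (hs : IsHodgeMultiset s)
    (hsym : ∀ x : (ZMod (p * q))ˣ, Multiset.count (x : ZMod (p * q)) s = Multiset.count (-(x : ZMod (p * q))) s)
    {x : ZMod (p * q)} (hx0 : x ≠ 0) (hx : ¬ IsUnit x) (hx5 : ZMod.castHom (dvd_mul_right p q) (ZMod p) x ≠ 0) :
    Multiset.count x s = Multiset.count (-x) s := by
  classical
  have hnx0 : -x ≠ 0 := neg_ne_zero.mpr hx0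
  have hnx : ¬ IsUnit (-x) := fun h ↦ hx (by simpa using h.neg)
  have hnx5 : ZMod.castHom (dvd_mul_right p q) (ZMod p) (-x) ≠ 0 := by rw [map_neg, neg_ne_zero]; exact hx5
  rw [count_eq_card_filter_of_level_p hpq hs.1.1 hx0 hx hx5,
    count_eq_card_filter_of_level_p hpq hs.1.1 hnx0 hnx hnx5, map_neg]
  set F : ZMod p → ℂ := fun y ↦ Multiset.card ((s.filter fun z ↦ ¬ IsUnit z).filter
    fun z ↦ ZMod.castHom (dvd_mul_right p q) (ZMod p) z = y) with hF
  have hxunit : IsUnit (ZMod.castHom (dvd_mul_right p q) (ZMod p) x) := (isUnit_iff_ne_zero_prime _).mpr hx5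
  have key := even_of_orthogonal_odd F ?_ hxunit.unit
  · simp only [IsUnit.unit_spec, hF] at key
    exact_mod_cast key
  intro ψ hψ
  rw [hF, sum_card_filter_nonunit_mul']
  have h2 := stub_twoPrime_level_left p q hpq s hs ψ⁻¹ (inv_neg_one_of_odd hψ) (ne_one_of_odd (inv_neg_one_of_odd hψ))
  rw [← Multiset.filter_add_not (p := IsUnit) s, Multiset.map_add, Multiset.sum_add] at h2
  have hunit : ((s.filter IsUnit).map fun y ↦
      (if IsUnit y then (1 - ψ⁻¹ ((q : ℕ) : ZMod p)) else ((q - 1 : ℕ) : ℂ) * ψ⁻¹ ((q : ℕ) : ZMod p)) *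
        (ψ⁻¹ (ZMod.castHom (dvd_mul_right p q) (ZMod p) y))⁻¹).sum = 0 := by
    have : ((s.filter IsUnit).map fun y ↦
        (if IsUnit y then (1 - ψ⁻¹ ((q : ℕ) : ZMod p)) else ((q - 1 : ℕ) : ℂ) * ψ⁻¹ ((q : ℕ) : ZMod p)) *
          (ψ⁻¹ (ZMod.castHom (dvd_mul_right p q) (ZMod p) y))⁻¹) =
        ((s.filter IsUnit).map fun y ↦ (1 - ψ⁻¹ ((q : ℕ) : ZMod p)) * ψ (ZMod.castHom (dvd_mul_right p q) (ZMod p) y)) := by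
      refine Multiset.map_congr rfl fun y hy ↦ ?_
      rw [Multiset.mem_filter] at hy
      rw [if_pos hy.2, inv_inv_apply]
    rw [this, Multiset.sum_map_mul_left,
      sum_filter_isUnit_eq_zero hsym (fun y ↦ ψ (ZMod.castHom (dvd_mul_right p q) (ZMod p) y)) ?_, mul_zero]
    intro y
    rw [map_neg, ← neg_one_mul, map_mul, hψ, neg_one_mul]
  rw [hunit, zero_add] at h2
  have hnon : ((s.filter fun y ↦ ¬ IsUnit y).map fun y ↦
      (if IsUnit y then (1 - ψ⁻¹ ((q : ℕ) : ZMod p)) else ((q - 1 : ℕ) : ℂ) * ψ⁻¹ ((q : ℕ) : ZMod p)) *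
        (ψ⁻¹ (ZMod.castHom (dvd_mul_right p q) (ZMod p) y))⁻¹) =
      ((s.filter fun y ↦ ¬ IsUnit y).map fun y ↦
        (((q - 1 : ℕ) : ℂ) * ψ⁻¹ ((q : ℕ) : ZMod p)) * ψ (ZMod.castHom (dvd_mul_right p q) (ZMod p) y)) := by
    refine Multiset.map_congr rfl fun y hy ↦ ?_
    rw [Multiset.mem_filter] at hy
    rw [if_neg hy.2, inv_inv_apply]
  rw [hnon, Multiset.sum_map_mul_left] at h2
  have hqu : IsUnit ((q : ℕ) : ZMod p) := by
    rw [ZMod.isUnit_prime_iff_not_dvd Fact.out]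
    intro h
    exact hpq ((Nat.prime_dvd_prime_iff_eq Fact.out (Fact.out : p.Prime)).mp h).symm
  have hne : (((q - 1 : ℕ) : ℂ) * ψ⁻¹ ((q : ℕ) : ZMod p)) ≠ 0 := by
    refine mul_ne_zero ?_ ?_
    · have hq2 : 2 ≤ q := (Fact.out : q.Prime).two_le
      have : (q - 1 : ℕ) ≠ 0 := by omega
      exact_mod_cast this
    · rw [MulChar.inv_apply_eq_inv']
      exact inv_ne_zero ((hqu.map ψ).ne_zero)
  exact (mul_eq_zero.mp h2).resolve_left hne

/-! ### §4 The symmetric case: pairs -/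

/-- **If the unit part of a Hodge multiset of level `pq` is symmetric, the multiset is a sum of pairs
`{a, -a}`** (all `a ≠ 0`). [cite: Aoki1983, Prop. 2.2] -/
theorem exists_pairs_of_symmetric_pq : ∀ {p q : ℕ} [Fact p.Prime] [Fact q.Prime], p ≠ 2 → q ≠ 2 → p ≠ q →
    ∀ {s : Multiset (ZMod (p * q))}, IsHodgeMultiset s →
    (∀ x : (ZMod (p * q))ˣ, Multiset.count (x : ZMod (p * q)) s = Multiset.count (-(x : ZMod (p * q))) s) →
    ∃ Q : Multiset (ZMod (p * q)), (∀ a ∈ Q, a ≠ 0) ∧ s = Q + Q.map (fun a ↦ -a) := by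
  intro p q _ _ hp2 hq2 hpq s hs hsym
  classical
  have hall : ∀ x : ZMod (p * q), Multiset.count (-x) s = Multiset.count x s := by
    intro x
    by_cases hx0 : x = 0
    · rw [hx0, neg_zero]
    rcases trichotomy hpq hx0 with hu | ⟨hx5, hxq⟩ | ⟨hx5, hxq⟩
    · exact (hsym hu.unit).symm
    · have hx : ¬ IsUnit x := fun h ↦ cast_ne_zero_of_isUnit' h hx5
      exact (count_symm_level_q hpq hs hsym hx0 hx hxq).symm
    · have hx : ¬ IsUnit x := fun h ↦ cast_ne_zero_of_isUnit h hxq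
      exact (count_symm_level_p hpq hs hsym hx0 hx hx5).symm
  have heven : ∀ x : ZMod (p * q), x = -x → Even (Multiset.count x s) := by
    intro x hx
    -- `x = -x` forces `x = 0` (odd modulus), which does not occur
    have h2 : (2 : ZMod (p * q)) * x = 0 := by linear_combination hx
    have h2u : IsUnit (2 : ZMod (p * q)) := by
      have : ((2 : ℕ) : ZMod (p * q)) = 2 := by norm_cast
      rw [← this, ZMod.isUnit_iff_coprime, Nat.coprime_two_left]
      exact Nat.odd_mul.mpr ⟨(Fact.out : p.Prime).odd_of_ne_two hp2, (Fact.out : q.Prime).odd_of_ne_two hq2⟩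
    have hx0 : x = 0 := (h2u.mul_right_eq_zero).mp h2
    rw [hx0, Multiset.count_eq_zero_of_notMem (fun h ↦ hs.1.1 0 h rfl)]
    exact Even.zero
  obtain ⟨Q, hQ⟩ := exists_eq_add_map_neg s hall heven
  refine ⟨Q, fun a ha ↦ hs.1.1 a ?_, hQ⟩
  rw [hQ]; exact Multiset.mem_add.mpr (Or.inl ha)

end LevelPQ

end Summit.HodgeConjecture.HodgeConjecture.Theorems.CancelByAnyClaimLattice.PQ
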